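import Summits.CriticalPhenomena.PercolationContinuityZ3.Theorems.PercNearOneGluingNoHeavyLowerTailAntitheticReachN
import Mathlib.Combinatorics.SimpleGraph.Connectivity.Finite
import HarnessLib

/-!
# `NoHeavyLowerTail` (stmt-CriticalPhenomena-4575) — antithetic cluster pairs: **`K_{2,4}` FROM A POLE IS NOT ⊕-POSITIVE** — a checked
# COUNTEREXAMPLE to the K-form ⊕-hypothesis for the rooted gadget `K24` (poles `s = 0`, target `c = 1`, middles `2, 3, 4, 5`;
# prim-hp-2 gen 65, HOME/MEMO-gen65.md §3)

Support file (`--supports stmt-CriticalPhenomena-4575`, hull-port prover `prim-hp-2`, gen 65).  No definitions, no named facts, no sorries;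
COMPUTATIONAL (`native_decide` evaluates one integer sum over the 256 sub-colourings).  Negative result: it kills no item and no theorem —
it corrects the census record.  HOME/THEOREM-Fans.md (gen 58) and HOME/MEMO-gen64.md §4 state "`K_{2,k}` from a pole is ⊕ iff `k ≤ 4`" on
the strength of the alternating best-response adversary (HOME/code/gen61 `oplus_adv.py`); exact enumeration of ALL up-sets of the pair poset
(HOME/code/gen65/lab65/exact_oplus.py) finds the ODD twisted-monotone pair below with `Σ_{c ∈ X} K₁K₂ = −3`, which the adversary missed.
(The ttrl lane's exact statement "K24 ⊕ in BIC-form" concerns the smaller class `K(X,Y) = F(X) − F(Y)` of one-set functions and is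
consistent: `K_{2,4}` separates BIC-form positivity from the K-form positivity that the handle theorems (…AntitheticHandleDual) consume.)

THE WITNESS.  `W = {1,…,5}` (all vertices but the source); an up-set of pairs is given by generators `(P_g, Q_g)`:
`𝟙_G(A, B) = [∃ g ∈ G, P_g ⊆ A ∧ B ∩ W ⊆ Q_g]` (twisted-monotone); the odd test function of `G` is `K_G(A, B) = 𝟙_G(A, B) − 𝟙_G(B, A)`
(twisted-monotone and odd, hence super-odd).  With
`G₁ = [({1,4},{1,2,3,5}), ({3,4,5},{1,2,3,4,5}), ({1,4,5},{1,2,3,4})]` and `G₂ = [({1,2},{1,3,4,5}), ({1,2,3},{1,2,4,5}), ({1,2,3,5},{1,2,3,4})]`: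
`Σ_{θ ⊆ E₁, c ∈ X θ} K_{G₁}(X θ, Y θ) · K_{G₂}(X θ, Y θ) = −3` (175 sub-colourings in the event; the twelve colourings with one middle doubly red,
one doubly blue and two mixed contribute `−4` each).
* `Antithetic.K24.exists_negative_pair` — the witness, in the powerset/`openCluster` form of the certificate files (…AntitheticK4Oplus).
* `Antithetic.K24.not_oplus_powerset` — hence `(K_{2,4}, pole, pole)` is NOT ⊕-positive: the hypothesis `(⊕)` of the DUAL HANDLE THEOREM
  fails for this core (although CONJECTURE Δ2 holds for `K_{2,4} + x` by the n ≤ 7 census), and every adversary-based "⊕" verdict of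
  gens 58–64 is unverified until re-decided exactly (kit j283760).
[cite: VandenbergHaggstromKahn2005, §1 p. 3 (open cluster `C_s`)]
-/

namespace Summit.CriticalPhenomena.PercolationContinuityZ3.Theorems

open Literature.Probability.Percolation

namespace Antithetic

namespace K24

set_option maxRecDepth 8192 in
/-- **An explicit odd twisted-monotone pair with negative ⊕-sum on `K_{2,4}` (pole to pole).**  There are twisted-monotone super-odd
`K₁, K₂ : Set (Fin 6) → Set (Fin 6) → ℝ` with `Σ_{θ ⊆ E₁, 1 ∈ X θ} K₁ (X θ) (Y θ) * K₂ (X θ) (Y θ) < 0`, where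
`E₁ = {02, 03, 04, 05, 12, 13, 14, 15}`, `X θ = openCluster ↑θ 0`, `Y θ = openCluster ↑(E₁ \ θ) 0`. [this work, checked computation] -/
theorem exists_negative_pair : ∃ K₁ K₂ : Set (Fin 6) → Set (Fin 6) → ℝ,
    (∀ ⦃A A' B B' : Set (Fin 6)⦄, A ⊆ A' → B' ⊆ B → K₁ A B ≤ K₁ A' B') ∧ (∀ A B, 0 ≤ K₁ A B + K₁ B A) ∧
    (∀ ⦃A A' B B' : Set (Fin 6)⦄, A ⊆ A' → B' ⊆ B → K₂ A B ≤ K₂ A' B') ∧ (∀ A B, 0 ≤ K₂ A B + K₂ B A) ∧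
    ∑ θ ∈ ((Finset.powerset ({s(0, 2), s(0, 3), s(0, 4), s(0, 5), s(1, 2), s(1, 3), s(1, 4), s(1, 5)} : Finset (Sym2 (Fin 6)))).filter
        fun (θ : Finset (Sym2 (Fin 6))) => (SimpleGraph.fromEdgeSet (↑θ : Set (Sym2 (Fin 6)))).Reachable 0 1),
      K₁ (openCluster (↑θ : Set (Sym2 (Fin 6))) 0) (openCluster (↑(({s(0, 2), s(0, 3), s(0, 4), s(0, 5), s(1, 2), s(1, 3), s(1, 4), s(1, 5)} :
          Finset (Sym2 (Fin 6))) \ θ) : Set (Sym2 (Fin 6))) 0) *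
      K₂ (openCluster (↑θ : Set (Sym2 (Fin 6))) 0) (openCluster (↑(({s(0, 2), s(0, 3), s(0, 4), s(0, 5), s(1, 2), s(1, 3), s(1, 4), s(1, 5)} :
          Finset (Sym2 (Fin 6))) \ θ) : Set (Sym2 (Fin 6))) 0) < 0 := by
  -- the odd test function of a list of generators, at the Finset level (computable)
  have hmono : ∀ (G : List (Finset (Fin 6) × Finset (Fin 6))) ⦃A A' B B' : Finset (Fin 6)⦄, A ⊆ A' → B' ⊆ B →
      ((if ∃ g ∈ G, g.1 ⊆ A ∧ B ∩ ({1, 2, 3, 4, 5} : Finset (Fin 6)) ⊆ g.2 then (1 : ℤ) else 0) -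
        (if ∃ g ∈ G, g.1 ⊆ B ∧ A ∩ ({1, 2, 3, 4, 5} : Finset (Fin 6)) ⊆ g.2 then (1 : ℤ) else 0)) ≤
      ((if ∃ g ∈ G, g.1 ⊆ A' ∧ B' ∩ ({1, 2, 3, 4, 5} : Finset (Fin 6)) ⊆ g.2 then (1 : ℤ) else 0) -
        (if ∃ g ∈ G, g.1 ⊆ B' ∧ A' ∩ ({1, 2, 3, 4, 5} : Finset (Fin 6)) ⊆ g.2 then (1 : ℤ) else 0)) := by
    intro G A A' B B' hA hB
    have h1 : (if ∃ g ∈ G, g.1 ⊆ A ∧ B ∩ ({1, 2, 3, 4, 5} : Finset (Fin 6)) ⊆ g.2 then (1 : ℤ) else 0) ≤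
        (if ∃ g ∈ G, g.1 ⊆ A' ∧ B' ∩ ({1, 2, 3, 4, 5} : Finset (Fin 6)) ⊆ g.2 then (1 : ℤ) else 0) := by
      split_ifs with ha hb
      · exact le_rfl
      · exact absurd (ha.imp fun g hg => ⟨hg.1, hg.2.1.trans hA, (Finset.inter_subset_inter_right hB).trans hg.2.2⟩) hb
      · exact zero_le_one
      · exact le_rfl
    have h2 : (if ∃ g ∈ G, g.1 ⊆ B' ∧ A' ∩ ({1, 2, 3, 4, 5} : Finset (Fin 6)) ⊆ g.2 then (1 : ℤ) else 0) ≤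
        (if ∃ g ∈ G, g.1 ⊆ B ∧ A ∩ ({1, 2, 3, 4, 5} : Finset (Fin 6)) ⊆ g.2 then (1 : ℤ) else 0) := by
      split_ifs with ha hb
      · exact le_rfl
      · exact absurd (ha.imp fun g hg => ⟨hg.1, hg.2.1.trans hB, (Finset.inter_subset_inter_right hA).trans hg.2.2⟩) hb
      · exact zero_le_one
      · exact le_rfl
    linarith
  have hodd : ∀ x y : ℤ, (0 : ℝ) ≤ ((x - y : ℤ) : ℝ) + ((y - x : ℤ) : ℝ) := fun x y => by push_cast; linarith
  -- cluster computations by the BFS ball `reachN`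
  have hX : ∀ θ : Finset (Sym2 (Fin 6)), openCluster (↑θ : Set (Sym2 (Fin 6))) 0 = ↑(reachN θ (0 : Fin 6) 5) := fun θ =>
    openCluster_eq_coe_reachN θ (0 : Fin 6) (by simp)
  have hD : ((Finset.powerset ({s(0, 2), s(0, 3), s(0, 4), s(0, 5), s(1, 2), s(1, 3), s(1, 4), s(1, 5)} : Finset (Sym2 (Fin 6)))).filter
        fun (θ : Finset (Sym2 (Fin 6))) => (SimpleGraph.fromEdgeSet (↑θ : Set (Sym2 (Fin 6)))).Reachable 0 1) =
      ((Finset.powerset ({s(0, 2), s(0, 3), s(0, 4), s(0, 5), s(1, 2), s(1, 3), s(1, 4), s(1, 5)} : Finset (Sym2 (Fin 6)))).filter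
        fun (θ : Finset (Sym2 (Fin 6))) => (1 : Fin 6) ∈ reachN θ (0 : Fin 6) 5) :=
    Finset.filter_congr fun θ _ => (mem_reachN_iff θ (0 : Fin 6) (1 : Fin 6) (by simp)).symm
  -- the witness: `K_{G}` on sets, through `Set.toFinset`
  refine ⟨fun A B => (((if ∃ g ∈ ([({1, 4}, {1, 2, 3, 5}), ({3, 4, 5}, {1, 2, 3, 4, 5}), ({1, 4, 5}, {1, 2, 3, 4})] :
        List (Finset (Fin 6) × Finset (Fin 6))), g.1 ⊆ @Set.toFinset _ A (Fintype.ofFinite A) ∧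
          @Set.toFinset _ B (Fintype.ofFinite B) ∩ ({1, 2, 3, 4, 5} : Finset (Fin 6)) ⊆ g.2 then (1 : ℤ) else 0) -
      (if ∃ g ∈ ([({1, 4}, {1, 2, 3, 5}), ({3, 4, 5}, {1, 2, 3, 4, 5}), ({1, 4, 5}, {1, 2, 3, 4})] :
        List (Finset (Fin 6) × Finset (Fin 6))), g.1 ⊆ @Set.toFinset _ B (Fintype.ofFinite B) ∧
          @Set.toFinset _ A (Fintype.ofFinite A) ∩ ({1, 2, 3, 4, 5} : Finset (Fin 6)) ⊆ g.2 then (1 : ℤ) else 0) : ℤ) : ℝ),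
    fun A B => (((if ∃ g ∈ ([({1, 2}, {1, 3, 4, 5}), ({1, 2, 3}, {1, 2, 4, 5}), ({1, 2, 3, 5}, {1, 2, 3, 4})] :
        List (Finset (Fin 6) × Finset (Fin 6))), g.1 ⊆ @Set.toFinset _ A (Fintype.ofFinite A) ∧
          @Set.toFinset _ B (Fintype.ofFinite B) ∩ ({1, 2, 3, 4, 5} : Finset (Fin 6)) ⊆ g.2 then (1 : ℤ) else 0) -
      (if ∃ g ∈ ([({1, 2}, {1, 3, 4, 5}), ({1, 2, 3}, {1, 2, 4, 5}), ({1, 2, 3, 5}, {1, 2, 3, 4})] :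
        List (Finset (Fin 6) × Finset (Fin 6))), g.1 ⊆ @Set.toFinset _ B (Fintype.ofFinite B) ∧
          @Set.toFinset _ A (Fintype.ofFinite A) ∩ ({1, 2, 3, 4, 5} : Finset (Fin 6)) ⊆ g.2 then (1 : ℤ) else 0) : ℤ) : ℝ),
    ?_, ?_, ?_, ?_, ?_⟩
  · -- twisted-monotone
    intro A A' B B' hA hB
    have hA' : @Set.toFinset _ A (Fintype.ofFinite A) ⊆ @Set.toFinset _ A' (Fintype.ofFinite A') :=
      (@Set.toFinset_subset_toFinset _ A A' (Fintype.ofFinite A) (Fintype.ofFinite A')).2 hA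
    have hB' : @Set.toFinset _ B' (Fintype.ofFinite B') ⊆ @Set.toFinset _ B (Fintype.ofFinite B) :=
      (@Set.toFinset_subset_toFinset _ B' B (Fintype.ofFinite B') (Fintype.ofFinite B)).2 hB
    have h := hmono ([({1, 4}, {1, 2, 3, 5}), ({3, 4, 5}, {1, 2, 3, 4, 5}), ({1, 4, 5}, {1, 2, 3, 4})] :
        List (Finset (Fin 6) × Finset (Fin 6))) hA' hB'
    dsimp only
    exact_mod_cast h
  · -- odd, hence super-odd (the second summand is the first with its two indicator terms exchanged)
    intro A B
    dsimp only
    exact hodd _ _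
  · intro A A' B B' hA hB
    have hA' : @Set.toFinset _ A (Fintype.ofFinite A) ⊆ @Set.toFinset _ A' (Fintype.ofFinite A') :=
      (@Set.toFinset_subset_toFinset _ A A' (Fintype.ofFinite A) (Fintype.ofFinite A')).2 hA
    have hB' : @Set.toFinset _ B' (Fintype.ofFinite B') ⊆ @Set.toFinset _ B (Fintype.ofFinite B) :=
      (@Set.toFinset_subset_toFinset _ B' B (Fintype.ofFinite B') (Fintype.ofFinite B)).2 hB
    have h := hmono ([({1, 2}, {1, 3, 4, 5}), ({1, 2, 3}, {1, 2, 4, 5}), ({1, 2, 3, 5}, {1, 2, 3, 4})] :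
        List (Finset (Fin 6) × Finset (Fin 6))) hA' hB'
    dsimp only
    exact_mod_cast h
  · intro A B
    dsimp only
    exact hodd _ _
  · -- the sum is `−3`
    rw [hD]
    simp only [hX, Finset.toFinset_coe]
    have hval : (∑ θ ∈ ((Finset.powerset ({s(0, 2), s(0, 3), s(0, 4), s(0, 5), s(1, 2), s(1, 3), s(1, 4), s(1, 5)} :
        Finset (Sym2 (Fin 6)))).filter fun (θ : Finset (Sym2 (Fin 6))) => (1 : Fin 6) ∈ reachN θ (0 : Fin 6) 5),
      ((if ∃ g ∈ ([({1, 4}, {1, 2, 3, 5}), ({3, 4, 5}, {1, 2, 3, 4, 5}), ({1, 4, 5}, {1, 2, 3, 4})] :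
          List (Finset (Fin 6) × Finset (Fin 6))), g.1 ⊆ reachN θ (0 : Fin 6) 5 ∧
            reachN (({s(0, 2), s(0, 3), s(0, 4), s(0, 5), s(1, 2), s(1, 3), s(1, 4), s(1, 5)} : Finset (Sym2 (Fin 6))) \ θ) (0 : Fin 6) 5 ∩
              ({1, 2, 3, 4, 5} : Finset (Fin 6)) ⊆ g.2 then (1 : ℤ) else 0) -
        (if ∃ g ∈ ([({1, 4}, {1, 2, 3, 5}), ({3, 4, 5}, {1, 2, 3, 4, 5}), ({1, 4, 5}, {1, 2, 3, 4})] :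
          List (Finset (Fin 6) × Finset (Fin 6))),
            g.1 ⊆ reachN (({s(0, 2), s(0, 3), s(0, 4), s(0, 5), s(1, 2), s(1, 3), s(1, 4), s(1, 5)} : Finset (Sym2 (Fin 6))) \ θ)
              (0 : Fin 6) 5 ∧ reachN θ (0 : Fin 6) 5 ∩ ({1, 2, 3, 4, 5} : Finset (Fin 6)) ⊆ g.2 then (1 : ℤ) else 0)) *
      ((if ∃ g ∈ ([({1, 2}, {1, 3, 4, 5}), ({1, 2, 3}, {1, 2, 4, 5}), ({1, 2, 3, 5}, {1, 2, 3, 4})] :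
          List (Finset (Fin 6) × Finset (Fin 6))), g.1 ⊆ reachN θ (0 : Fin 6) 5 ∧
            reachN (({s(0, 2), s(0, 3), s(0, 4), s(0, 5), s(1, 2), s(1, 3), s(1, 4), s(1, 5)} : Finset (Sym2 (Fin 6))) \ θ) (0 : Fin 6) 5 ∩
              ({1, 2, 3, 4, 5} : Finset (Fin 6)) ⊆ g.2 then (1 : ℤ) else 0) -
        (if ∃ g ∈ ([({1, 2}, {1, 3, 4, 5}), ({1, 2, 3}, {1, 2, 4, 5}), ({1, 2, 3, 5}, {1, 2, 3, 4})] :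
          List (Finset (Fin 6) × Finset (Fin 6))),
            g.1 ⊆ reachN (({s(0, 2), s(0, 3), s(0, 4), s(0, 5), s(1, 2), s(1, 3), s(1, 4), s(1, 5)} : Finset (Sym2 (Fin 6))) \ θ)
              (0 : Fin 6) 5 ∧ reachN θ (0 : Fin 6) 5 ∩ ({1, 2, 3, 4, 5} : Finset (Fin 6)) ⊆ g.2 then (1 : ℤ) else 0))) = -3 := by
      native_decide
    exact_mod_cast hval.trans_lt (by norm_num : (-3 : ℤ) < 0)

/-- **`K_{2,4}` from a pole is not ⊕-positive.**  The ⊕-hypothesis in the powerset form of the certificate files FAILS for `K24`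
(source `0`, target the other pole `1`): it is not the case that `Σ_{θ ⊆ E₁, 1 ∈ X θ} K₁K₂(X θ, Y θ) ≥ 0` for all twisted-monotone
super-odd `K₁, K₂`. [this work] -/
theorem not_oplus_powerset : ¬ ∀ K₁ K₂ : Set (Fin 6) → Set (Fin 6) → ℝ,
    (∀ ⦃A A' B B' : Set (Fin 6)⦄, A ⊆ A' → B' ⊆ B → K₁ A B ≤ K₁ A' B') → (∀ A B, 0 ≤ K₁ A B + K₁ B A) →
    (∀ ⦃A A' B B' : Set (Fin 6)⦄, A ⊆ A' → B' ⊆ B → K₂ A B ≤ K₂ A' B') → (∀ A B, 0 ≤ K₂ A B + K₂ B A) →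
    0 ≤ ∑ θ ∈ ((Finset.powerset ({s(0, 2), s(0, 3), s(0, 4), s(0, 5), s(1, 2), s(1, 3), s(1, 4), s(1, 5)} : Finset (Sym2 (Fin 6)))).filter
        fun (θ : Finset (Sym2 (Fin 6))) => (SimpleGraph.fromEdgeSet (↑θ : Set (Sym2 (Fin 6)))).Reachable 0 1),
      K₁ (openCluster (↑θ : Set (Sym2 (Fin 6))) 0) (openCluster (↑(({s(0, 2), s(0, 3), s(0, 4), s(0, 5), s(1, 2), s(1, 3), s(1, 4), s(1, 5)} :
          Finset (Sym2 (Fin 6))) \ θ) : Set (Sym2 (Fin 6))) 0) *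
      K₂ (openCluster (↑θ : Set (Sym2 (Fin 6))) 0) (openCluster (↑(({s(0, 2), s(0, 3), s(0, 4), s(0, 5), s(1, 2), s(1, 3), s(1, 4), s(1, 5)} :
          Finset (Sym2 (Fin 6))) \ θ) : Set (Sym2 (Fin 6))) 0) := by
  intro h
  obtain ⟨K₁, K₂, hK₁, hso₁, hK₂, hso₂, hlt⟩ := exists_negative_pair
  exact absurd (h K₁ K₂ hK₁ hso₁ hK₂ hso₂) (not_le.2 hlt)

end K24

end Antithetic

end Summit.CriticalPhenomena.PercolationContinuityZ3.Theorems
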